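import Literature.MathematicalPhysics.QuantumFieldTheory.Balaban1983to89.B12Eq44Ball
import Literature.MathematicalPhysics.QuantumFieldTheory.Balaban1983to89.B12Eq117Concrete

/-!
# `Balaban1983to89.B12Eq44From117` — T. Bałaban, *Renormalization group approach to lattice gauge field theories. I*,
Commun. Math. Phys. **109** (1987) 249–301 [Balaban1987RG1], p. 281 (4.4): **«we have the function E^{(j)}(X, exp iξ𝐀), i.e. the
function with 𝐔 = 1, 𝐉 = 0. Thus it is defined and analytic on the space of configurations 𝐀 satisfying max{|𝐀|_X, |P₁(□₀)𝐀|_X,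
|∇^ξ𝐀|_X, |Δ^ξ𝐀|_X} < α₂. (4.4)» — THE CONDITION-(iv) INPUT TAKEN FROM ITS PRINTED SOURCE (1.17) p. 263 (Proposition 9 [15]).**

HONEST FRAMING (cell `lit-balaban`, verbatim): statement-level skeleton of published theorems with citation tags; proofs where landed; nothing here is a claim about the Yang–Mills mass gap.

PDF held: `paper:balaban1987-cmp109-rg-i-small-field` (journal page = PDF page + 248); pp. 262–263 [PDF 14–15] and 281 [PDF 33]; the
render-based quotations are those of the headers of `B12Eq44Space` (p05), `B12Eq117Concrete` (p07) and `B12Decay510FromB11`.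

WHAT THIS MODULE DOES (SKELETON row `B12.Eq4.4`, display owner r09, fold owner r20 = this unit).  The printed sentence of (4.4) is
PROVED on the concrete carriers by `B12Eq44Space.analyticOnNhd_E_sub310_one` / `B12Eq44Ball.analyticOnNhd_E_sub310_one_ball` (p05 g7)
with condition (iv) (1.16) of the membership `(exp iξ𝐀, J(exp iξ𝐀)) ∈ U^c_j(X, α₀, α₁)` entering AS DATA (`hIV`, `hIV₁`) — a
conclusion-shaped hypothesis, which is why both owners keep the row's head `typed-existing (+ proved … CONDITIONAL)` (ROWS-B12 r09 v2.57 /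
r20 v1.42, lead ruling G.5-45 (iii)).  The print's own source for (iv) is p. 263: *«From Proposition 9 [15] we obtain |∂U_n(M˙(𝐔)) − 1| <
B₃2α₀′L^{−2n}(L^nξ)² = 2B₃α₀′ξ², |J_n(M˙(𝐔))| < B₃2α₀′(L^nξ)² on X̃^{−2}. (1.17) It is obvious that for α₀′ sufficiently small the
above estimates imply the condition (iv)»* — the output (1.17) of Proposition 9 [15] applied to every configuration `V` with
`|∂V − 1| < α₀′ξ²` on `X`, typed in exactly this shape by `B12Eq117Concrete` (p07 g6; row `B12.Eq1.17`, [15] = [Balaban1985Variational] =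
cell paper B11, row `B11.Prop9`), with «α₀′ sufficiently small» = `2B₃α₀′ ≤ α₀` (`B12Eq117Concrete.condIV_of_prop9Shape`).  HERE the two
(iv)-hypotheses of p05's theorems are DISCHARGED from that printed input: for `V = exp iξ𝐀`, `𝐀` in the (4.4)-set, the premise
`|∂ exp iξ𝐀 − 1| < α₀′ξ²` is p05's `B12Eq44Space.norm_plaq_sub310_one_sub_one_lt` (under `8α₂ < α₀′` — «α₂, depending on α₀ and on some
absolute constants», p. 272, now also on [15]'s `B₃` through `2B₃α₀′ ≤ α₀`), and for `V = 1` it is `|∂1 − 1| = 0`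
(`B12RegularSpaces111Mono.plaq_one`).  Result: the printed sentence with the hypotheses = the p. 263 analyticity of `E^{(j)}` on
`U^c_j(X, α₀, α₁)` (inductive hypothesis (1.18)), the (1.17)-shape on the (iv)-data (Proposition 9 [15] by reference, row `B12.Eq1.17`),
the Landau gauge of `𝐀` (the p. 272 context of (3.13)), the model data, and explicit smallness restrictions of printed shape — no
conclusion-shaped hypothesis left.

WHAT IS PROVED (theorems only; no `def`, no new `Prop`, no sorry; inputs BY NAME from `B12Eq44Space`, `B12Eq44Ball`, `B12Eq117Concrete`):
§1 `condIV_sub310_one_of_prop9Shape` ((1.17) ⇒ (iv) for `exp iξ𝐀`), `condIV_one_of_prop9Shape` ((1.17) ⇒ (iv) for `1`);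
§2 `ofBackground_sub310_one_mem_space'_of_prop9Shape` («defined»), **`analyticOnNhd_E_sub310_one_of_prop9Shape`** (the printed sentence);
§3 **`analyticOnNhd_E_sub310_one_ball_of_prop9Shape`** (the sentence on the open `α₂`-ball of the (4.4)-normed space `B12Eq44Ball.Cfg44`).
NOT here: Proposition 9 [15] itself (hypothesis shape, as in `B12Eq117Concrete`); the identification of `P`, `R` with [15]'s operators.
Unit `lit-balaban-r20` (B12 fold owner, gen 10; TAKING line HOME/STATUS.md 2026-08-21T20:24:36Z), HOME `run/shared/lean/pub/lit-balaban/`.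
-/

open NormedSpace Complex

namespace Literature.MathematicalPhysics.QuantumFieldTheory.Balaban1983to89.B12Eq44From117

open Literature.MathematicalPhysics.QuantumFieldTheory.Balaban1983to89
open Literature.MathematicalPhysics.QuantumFieldTheory.Balaban1983to89.B9Eq37Insertion
open Literature.MathematicalPhysics.QuantumFieldTheory.Balaban1983to89.B9Eq39Adjoint
open Literature.MathematicalPhysics.QuantumFieldTheory.Balaban1983to89.B9TorusCalculus
open Literature.MathematicalPhysics.QuantumFieldTheory.Balaban1983to89.B12RegularSpaces111
open Literature.MathematicalPhysics.QuantumFieldTheory.Balaban1983to89.B12Eq18Current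
open Literature.MathematicalPhysics.QuantumFieldTheory.Balaban1983to89.B12Eq311CurrentExpansion
open Literature.MathematicalPhysics.QuantumFieldTheory.Balaban1983to89.B12Eq44Space
open Literature.MathematicalPhysics.QuantumFieldTheory.Balaban1983to89.B12Eq44Ball

noncomputable section

variable {P : Params} {i : ℕ} {𝔸 : Type*} [NormedRing 𝔸] [NormedAlgebra ℂ 𝔸] [CompleteSpace 𝔸] [NormOneClass 𝔸]

/-! ## §1. (1.17) ⇒ condition (iv) for the two configurations of (4.4): `exp iξ𝐀` and `1` -/

/-- **(1.17) ⇒ (iv) for `exp iξ𝐀`, `𝐀` in the (4.4)-set.**  If the output (1.17) of Proposition 9 [15] holds on the (iv)-data of every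
configuration `V` with `|∂V − 1| < α₀′ξ²` on `X` (the hypothesis shape of `B12Eq117Concrete`, verbatim), `2B₃α₀′ ≤ α₀` («for α₀′
sufficiently small»), `L ≠ 0`, and `𝐀` lies in the (4.4)-set with `0 < ξ ≤ 1`, `0 ≤ α₂ ≤ ¼`, `8α₂ < α₀′` (so that `|∂ exp iξ𝐀 − 1| < α₀′ξ²`,
`B12Eq44Space.norm_plaq_sub310_one_sub_one_lt`), then `exp iξ𝐀` satisfies condition (iv) (1.16) with `α₀`.
[cite: Balaban1987RG1, (1.17) p.263 with (4.4) p.281] -/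
theorem condIV_sub310_one_of_prop9Shape {F : Frame P i 𝔸} {c : StepConsts} {π : 𝔸 →ₗ[ℂ] 𝔸}
    {Pop : (Site P i → 𝔸) → (Site P i → 𝔸)} (hL : c.L ≠ 0) {B₃ α₀' α₀ α₂ : ℝ} (hsmall : 2 * B₃ * α₀' ≤ α₀)
    (hξ : 0 < c.ξ) (hξ1 : c.ξ ≤ 1) (hα₂ : 0 ≤ α₂) (hα₂q : α₂ ≤ 1 / 4) (h8' : 8 * α₂ < α₀')
    (h117 : ∀ V : PBond P i → 𝔸ˣ, (∀ p ∈ F.X.plaqs, ‖(↑(plaq V p) : 𝔸) - 1‖ < α₀' * c.ξ ^ 2) → ∀ n, 1 ≤ n → n ≤ c.j →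
      (∀ p ∈ F.X₂.plaqs, ‖(↑(plaq (F.bg.Un n V) p) : 𝔸) - 1‖ < B₃ * (2 * α₀') * (c.L ^ n)⁻¹ ^ 2 * (c.L ^ n * c.ξ) ^ 2) ∧
      (∀ b ∈ F.X₂.bonds, ‖F.bg.Jn n V b‖ < B₃ * (2 * α₀') * (c.L ^ n * c.ξ) ^ 2))
    {A : PBond P i → 𝔸} (hA : A ∈ space44 π Pop c.ξ α₂) :
    CondIV F.bg F.X₂ c α₀ (sub310 c.ξ A (1 : PBond P i → 𝔸ˣ)) :=
  B12Eq117Concrete.condIV_of_prop9Shape hL hsmall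
    (h117 _ fun p _ => norm_plaq_sub310_one_sub_one_lt hξ hξ1 hα₂ hα₂q h8' hA.1 hA.2.1 p)

omit [NormedAlgebra ℂ 𝔸] [CompleteSpace 𝔸] [NormOneClass 𝔸] in
/-- **(1.17) ⇒ (iv) for the unit configuration** («the same bounds hold for U instead of 𝐔», here `U = 1`): `|∂1 − 1| = 0 < α₀′ξ²`
(`α₀′ > 0`, `ξ ≠ 0`), so the (1.17)-shape applies to `V = 1` and gives condition (iv) with `α₀` when `2B₃α₀′ ≤ α₀`.
[cite: Balaban1987RG1, (1.17) p.263, (1.16) p.262] -/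
theorem condIV_one_of_prop9Shape {F : Frame P i 𝔸} {c : StepConsts} (hL : c.L ≠ 0) {B₃ α₀' α₀ : ℝ}
    (hsmall : 2 * B₃ * α₀' ≤ α₀) (hα₀' : 0 < α₀') (hξ : c.ξ ≠ 0)
    (h117 : ∀ V : PBond P i → 𝔸ˣ, (∀ p ∈ F.X.plaqs, ‖(↑(plaq V p) : 𝔸) - 1‖ < α₀' * c.ξ ^ 2) → ∀ n, 1 ≤ n → n ≤ c.j →
      (∀ p ∈ F.X₂.plaqs, ‖(↑(plaq (F.bg.Un n V) p) : 𝔸) - 1‖ < B₃ * (2 * α₀') * (c.L ^ n)⁻¹ ^ 2 * (c.L ^ n * c.ξ) ^ 2) ∧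
      (∀ b ∈ F.X₂.bonds, ‖F.bg.Jn n V b‖ < B₃ * (2 * α₀') * (c.L ^ n * c.ξ) ^ 2)) :
    CondIV F.bg F.X₂ c α₀ (1 : PBond P i → 𝔸ˣ) :=
  B12Eq117Concrete.condIV_of_prop9Shape hL hsmall
    (h117 _ fun p _ => by
      rw [B12RegularSpaces111Mono.plaq_one, Units.val_one, sub_self, norm_zero]
      exact mul_pos hα₀' (by positivity))

/-! ## §2. «defined and analytic» with (iv) from (1.17) -/

/-- **«defined»: `(exp iξ𝐀, J(exp iξ𝐀)) ∈ U^c_j(X, α₀, α₁)`** for `𝔤ᶜ`-valued Landau-gauge `𝐀` in the (4.4)-set — p05's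
`B12Eq44Space.ofBackground_sub310_one_mem_space'` with its two (iv)-hypotheses supplied by §1 from the (1.17)-shape (Proposition 9 [15])
and `2B₃α₀′ ≤ α₀`, `8α₂ < α₀′ ≤ α₀`. [cite: Balaban1987RG1, (4.4) p.281 with (1.17) p.263] -/
theorem ofBackground_sub310_one_mem_space'_of_prop9Shape (𝓜 : Model 𝔸) {F : Frame P i 𝔸} {c : StepConsts} {π : 𝔸 →ₗ[ℂ] 𝔸}
    {Rop Pop : (Site P i → 𝔸) → (Site P i → 𝔸)} {α₀ α₁ α₂ Cπ B₃ α₀' : ℝ}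
    (hξ : 0 < c.ξ) (hξ1 : c.ξ ≤ 1) (hcB : 0 < c.cB) (hL : c.L ≠ 0) (hα₀ : 0 < α₀) (hα₀1 : α₀ ≤ 1) (hα₂ : 0 ≤ α₂)
    (hα₂q : α₂ ≤ 1 / 4) (hα₂α₁ : α₂ ≤ α₁) (hα₀' : α₀' ≤ α₀) (h8' : 8 * α₂ < α₀') (hsmall : 2 * B₃ * α₀' ≤ α₀)
    (hCπ : 0 ≤ Cπ) (hπn : ∀ X, ‖π X‖ ≤ Cπ * ‖X‖)
    (hπgc : ∀ X, π X ∈ 𝓜.gc) (hgcAd : ∀ g ∈ 𝓜.Gc, ∀ X ∈ 𝓜.gc, R g X ∈ 𝓜.gc) (heGc : ∀ a ∈ 𝓜.gc, expI c.ξ a ∈ 𝓜.Gc)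
    (hRP : ∀ f : Site P i → 𝔸, Rop f + Pop f = f)
    (hres : (2 + (P.d - 1) * (Cπ * (C311 1 + 2 * 1 ^ 14))) * α₂ ≤ α₀)
    (h117 : ∀ V : PBond P i → 𝔸ˣ, (∀ p ∈ F.X.plaqs, ‖(↑(plaq V p) : 𝔸) - 1‖ < α₀' * c.ξ ^ 2) → ∀ n, 1 ≤ n → n ≤ c.j →
      (∀ p ∈ F.X₂.plaqs, ‖(↑(plaq (F.bg.Un n V) p) : 𝔸) - 1‖ < B₃ * (2 * α₀') * (c.L ^ n)⁻¹ ^ 2 * (c.L ^ n * c.ξ) ^ 2) ∧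
      (∀ b ∈ F.X₂.bonds, ‖F.bg.Jn n V b‖ < B₃ * (2 * α₀') * (c.L ^ n * c.ξ) ^ 2))
    {A : PBond P i → 𝔸} (hA : A ∈ space44 π Pop c.ξ α₂) (hAgc : ∀ b, A b ∈ 𝓜.gc)
    (hLan : Rop (fun y => ((c.ξ : ℂ)⁻¹) •
      divB (torusT P i) (dirForm (1 : PBond P i → 𝔸ˣ)) (dirForm A) y) = 0) :
    ofBackground π c.ξ (sub310 c.ξ A (1 : PBond P i → 𝔸ˣ)) ∈ space' 𝓜 F c α₀ α₁ :=
  ofBackground_sub310_one_mem_space' 𝓜 hξ hξ1 hcB hα₀ hα₀1 hα₂ hα₂q hα₂α₁ (h8'.trans_le hα₀') hCπ hπn hπgc hgcAd heGc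
    hRP hres hA hAgc hLan (condIV_sub310_one_of_prop9Shape hL hsmall hξ hξ1 hα₂ hα₂q h8' h117 hA)
    (condIV_one_of_prop9Shape hL hsmall (lt_of_le_of_lt (by positivity) h8') hξ.ne' h117)

variable {V : Type*} [NormedAddCommGroup V] [NormedSpace ℂ V]

/-- **[B12 (4.4)] «Thus it is defined and analytic on the space of configurations 𝐀 satisfying (4.4)» with the (iv)-input from its
printed source (1.17).**  Let `E : (bonds → 𝔸) × (bonds → 𝔸) → V` be analytic at every point of `U^c_j(X, α₀, α₁)` (p. 263, the inductive
hypothesis (1.18)), let the output (1.17) of Proposition 9 [15] hold on the (iv)-data of every `V` with `|∂V − 1| < α₀′ξ²` on `X`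
(row `B12.Eq1.17`; `2B₃α₀′ ≤ α₀`, `α₀′ ≤ α₀`), `π` the projection onto `𝔤ᶜ` with `‖πX‖ ≤ Cπ‖X‖`, `exp iξ·: 𝔤ᶜ → Gᶜ`, `𝔤ᶜ` `Ad(Gᶜ)`-stable,
`R + P = I`, `0 < ξ ≤ 1`, `L ≠ 0`, `O(1)LMB > 0`, `0 < α₀ ≤ 1`, `0 ≤ α₂ ≤ min{¼, α₁}`, `8α₂ < α₀′`, `(2 + C_J)α₂ ≤ α₀`.  Then
`𝐀 ↦ E^{(j)}(X, exp iξ𝐀) := E(exp iξ𝐀, J(exp iξ𝐀))` is analytic at every `𝔤ᶜ`-valued Landau-gauge `𝐀` of the (4.4)-set — p05's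
`B12Eq44Space.analyticOnNhd_E_sub310_one` with `hIV`, `hIV₁` discharged by §1. [cite: Balaban1987RG1, (4.4) p.281 with (1.17) p.263] -/
theorem analyticOnNhd_E_sub310_one_of_prop9Shape (𝓜 : Model 𝔸) {F : Frame P i 𝔸} {c : StepConsts}
    {π : 𝔸 →ₗ[ℂ] 𝔸} {Rop Pop : (Site P i → 𝔸) → (Site P i → 𝔸)} {α₀ α₁ α₂ Cπ B₃ α₀' : ℝ}
    (hξ : 0 < c.ξ) (hξ1 : c.ξ ≤ 1) (hcB : 0 < c.cB) (hL : c.L ≠ 0) (hα₀ : 0 < α₀) (hα₀1 : α₀ ≤ 1) (hα₂ : 0 ≤ α₂)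
    (hα₂q : α₂ ≤ 1 / 4) (hα₂α₁ : α₂ ≤ α₁) (hα₀' : α₀' ≤ α₀) (h8' : 8 * α₂ < α₀') (hsmall : 2 * B₃ * α₀' ≤ α₀)
    (hCπ : 0 ≤ Cπ) (hπn : ∀ X, ‖π X‖ ≤ Cπ * ‖X‖)
    (hπgc : ∀ X, π X ∈ 𝓜.gc) (hgcAd : ∀ g ∈ 𝓜.Gc, ∀ X ∈ 𝓜.gc, R g X ∈ 𝓜.gc) (heGc : ∀ a ∈ 𝓜.gc, expI c.ξ a ∈ 𝓜.Gc)
    (hRP : ∀ f : Site P i → 𝔸, Rop f + Pop f = f)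
    (hres : (2 + (P.d - 1) * (Cπ * (C311 1 + 2 * 1 ^ 14))) * α₂ ≤ α₀)
    (E : (PBond P i → 𝔸) × (PBond P i → 𝔸) → V)
    (hE : ∀ Φ ∈ space' 𝓜 F c α₀ α₁, AnalyticAt ℂ E ((fun b => (Φ.U b : 𝔸)), Φ.J))
    (h117 : ∀ V : PBond P i → 𝔸ˣ, (∀ p ∈ F.X.plaqs, ‖(↑(plaq V p) : 𝔸) - 1‖ < α₀' * c.ξ ^ 2) → ∀ n, 1 ≤ n → n ≤ c.j →
      (∀ p ∈ F.X₂.plaqs, ‖(↑(plaq (F.bg.Un n V) p) : 𝔸) - 1‖ < B₃ * (2 * α₀') * (c.L ^ n)⁻¹ ^ 2 * (c.L ^ n * c.ξ) ^ 2) ∧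
      (∀ b ∈ F.X₂.bonds, ‖F.bg.Jn n V b‖ < B₃ * (2 * α₀') * (c.L ^ n * c.ξ) ^ 2)) :
    AnalyticOnNhd ℂ (fun A : PBond P i → 𝔸 =>
      E ((fun b => ((ofBackground π c.ξ (sub310 c.ξ A (1 : PBond P i → 𝔸ˣ))).U b : 𝔸)),
        (ofBackground π c.ξ (sub310 c.ξ A (1 : PBond P i → 𝔸ˣ))).J))
      (space44 π Pop c.ξ α₂ ∩ {A | (∀ b, A b ∈ 𝓜.gc) ∧
        Rop (fun y => ((c.ξ : ℂ)⁻¹) • divB (torusT P i) (dirForm (1 : PBond P i → 𝔸ˣ)) (dirForm A) y) = 0}) :=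
  analyticOnNhd_E_sub310_one 𝓜 hξ hξ1 hcB hα₀ hα₀1 hα₂ hα₂q hα₂α₁ (h8'.trans_le hα₀') hCπ hπn hπgc hgcAd heGc hRP hres E hE
    (condIV_one_of_prop9Shape hL hsmall (lt_of_le_of_lt (by positivity) h8') hξ.ne' h117)
    (fun _ hA => condIV_sub310_one_of_prop9Shape hL hsmall hξ hξ1 hα₂ hα₂q h8' h117 hA)

/-! ## §3. The same on the open `α₂`-ball of the (4.4)-normed space -/

/-- **[B12 (4.4)] as analyticity on the open ball `{‖𝐀‖₍₄.₄₎ < α₂}` of the (4.4)-normed space of `𝔤ᶜ`-valued Landau-gauge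
configurations (`B12Eq44Ball.Cfg44` over `landauSub`), with the (iv)-input from (1.17)** — p05's `B12Eq44Ball.analyticOnNhd_E_sub310_one_ball`
with `hIV`, `hIV₁` discharged by §1 (`R`, `P` ℂ-linear, `0 < α₂`). [cite: Balaban1987RG1, (4.4) p.281 with (1.17) p.263] -/
theorem analyticOnNhd_E_sub310_one_ball_of_prop9Shape (𝓜 : Model 𝔸) {F : Frame P i 𝔸} {c : StepConsts} {π : 𝔸 →ₗ[ℂ] 𝔸}
    {Rop Pop : (Site P i → 𝔸) →ₗ[ℂ] (Site P i → 𝔸)} {α₀ α₁ α₂ Cπ B₃ α₀' : ℝ}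
    (hξ : 0 < c.ξ) (hξ1 : c.ξ ≤ 1) (hcB : 0 < c.cB) (hL : c.L ≠ 0) (hα₀ : 0 < α₀) (hα₀1 : α₀ ≤ 1) (hα₂ : 0 < α₂)
    (hα₂q : α₂ ≤ 1 / 4) (hα₂α₁ : α₂ ≤ α₁) (hα₀' : α₀' ≤ α₀) (h8' : 8 * α₂ < α₀') (hsmall : 2 * B₃ * α₀' ≤ α₀)
    (hCπ : 0 ≤ Cπ) (hπn : ∀ X, ‖π X‖ ≤ Cπ * ‖X‖)
    (hπgc : ∀ X, π X ∈ 𝓜.gc) (hgcAd : ∀ g ∈ 𝓜.Gc, ∀ X ∈ 𝓜.gc, R g X ∈ 𝓜.gc) (heGc : ∀ a ∈ 𝓜.gc, expI c.ξ a ∈ 𝓜.Gc)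
    (hRP : ∀ f : Site P i → 𝔸, Rop f + Pop f = f)
    (hres : (2 + (P.d - 1) * (Cπ * (C311 1 + 2 * 1 ^ 14))) * α₂ ≤ α₀)
    (E : (PBond P i → 𝔸) × (PBond P i → 𝔸) → V)
    (hE : ∀ Φ ∈ space' 𝓜 F c α₀ α₁, AnalyticAt ℂ E ((fun b => (Φ.U b : 𝔸)), Φ.J))
    (h117 : ∀ V : PBond P i → 𝔸ˣ, (∀ p ∈ F.X.plaqs, ‖(↑(plaq V p) : 𝔸) - 1‖ < α₀' * c.ξ ^ 2) → ∀ n, 1 ≤ n → n ≤ c.j →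
      (∀ p ∈ F.X₂.plaqs, ‖(↑(plaq (F.bg.Un n V) p) : 𝔸) - 1‖ < B₃ * (2 * α₀') * (c.L ^ n)⁻¹ ^ 2 * (c.L ^ n * c.ξ) ^ 2) ∧
      (∀ b ∈ F.X₂.bonds, ‖F.bg.Jn n V b‖ < B₃ * (2 * α₀') * (c.L ^ n * c.ξ) ^ 2)) :
    AnalyticOnNhd ℂ ((fun A : PBond P i → 𝔸 =>
      E ((fun b => ((ofBackground π c.ξ (sub310 c.ξ A (1 : PBond P i → 𝔸ˣ))).U b : 𝔸)),
        (ofBackground π c.ξ (sub310 c.ξ A (1 : PBond P i → 𝔸ˣ))).J)) ∘ Cfg44.incl π Pop c.ξ (landauSub 𝓜 Rop c.ξ))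
      (Metric.ball (0 : Cfg44 π Pop c.ξ (landauSub 𝓜 Rop c.ξ)) α₂) :=
  analyticOnNhd_E_sub310_one_ball 𝓜 hξ hξ1 hcB hα₀ hα₀1 hα₂ hα₂q hα₂α₁ (h8'.trans_le hα₀') hCπ hπn hπgc hgcAd heGc hRP hres
    E hE (condIV_one_of_prop9Shape hL hsmall (lt_of_le_of_lt (by positivity) h8') hξ.ne' h117)
    (fun _ hA => condIV_sub310_one_of_prop9Shape hL hsmall hξ hξ1 hα₂.le hα₂q h8' h117 hA)

end

end Literature.MathematicalPhysics.QuantumFieldTheory.Balaban1983to89.B12Eq44From117
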